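import Mathlib
import HarnessLib
import Literature.Analysis.ValidatedNumerics.IntervalLogArctan
import Summits.KontsevichZagierPeriods.Zeta5Search.TwoTaleD1GrowthLimit
import Summits.KontsevichZagierPeriods.Zeta5Search.Denom.TwoTaleP15LineCertificate

/-!
# TwoTaleD1GrowthEnclosure — the numerical input `C₁* ≤ 60.8079` at RUNG D1 = L(1/3) is DISCHARGED (kernel interval arithmetic)

HONEST FRAMING: systematic search; no irrationality claim unless certified.  Cell pub-zeta5 (P1 g12, file T8 of
fam-denom's `families/denom/D1-DESIGN-NOTE.md`).  `TwoTaleD1Growth` / `TwoTaleD1GrowthLimit` prove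
`log (qhatD1 n) / n → C₁starD1 := rateΛD1 ustarD1`, where `ustarD1` is SOME zero of `slopeGD1` in `[57/2, 34]` chosen by
the intermediate value theorem.  This file PROVES the enclosure `C₁starD1 ≤ 60.8079` (design value `60.80787975`)
without locating `ustarD1` exactly — the D1 port of fam-measure's `TwoTaleR3GrowthEnclosure`, with the hand-made
logarithm enclosures replaced by the tree's kernel interval engine `Literature.Analysis.ValidatedNumerics`
(`MI.logPos`, scale `sc = 2^56` and term count `KL` of `Denom/TwoTaleP15LineCertificate`):
* `C₁starD1_le_tangent` — the SUPPORTING-LINE inequality `C₁starD1 ≤ rateΛD1 u + ustarD1·slopeGD1 u` for every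
  `u ∈ (47/2, 35)`;
* `slopeGD1_antitone` — all six logarithmic terms of `slopeGD1` are antitone on the window, hence
  `ustarD1_le_of_neg : slopeGD1 u₁ < 0 → ustarD1 ≤ u₁` (`u₁ > 47/2`);
* numerics ONLY at the rational abscissae `u₀ = 32229/1000` and `u₁ = 3223/100` (`u* = 32.22952…` lies between):
  the sixteen slope fractions are exact rationals, their logarithms are enclosed by `MI.logPos`, and ONE Boolean test
  `encCheckD1` (`decide +kernel`) certifies `0 ≤ slopeGD1 u₀`, `slopeGD1 u₁ < 0` and
  `rateΛD1 u₀ + u₁·slopeGD1 u₀ ≤ 60.8079`; whence **`C₁starD1_le : C₁starD1 ≤ 60.8079`** (and `≤ 60.808`, the form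
  used by the D1 note), since `C₁* ≤ Λ(u₀) + u*·G(u₀) ≤ Λ(u₀) + u₁·G(u₀)` (`G(u₀) ≥ 0`, `u* ≤ u₁`).
Design numerics (`HOME/code/p1/g12/d1_growth.py`): `Λ(u₀) = 60.793316`, `G(u₀) = 4.52·10⁻⁴`, `G(u₁) = −4.09·10⁻⁴`,
bound `60.8078801`, true `C₁ = 60.8078798`.  Nothing here certifies a measure; no irrationality content.
-/

noncomputable section

open Filter Topology Finset Real

namespace Summit.KontsevichZagierPeriods.Zeta5Search.TwoTaleD1Growth

open Summit.KontsevichZagierPeriods.Zeta5Search.TwoTaleP15Growth (tendsto_log_linear_div)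
open Summit.KontsevichZagierPeriods.Zeta5Search.Denom.TwoTaleP15LineCertificate (sc sc_pos KL mem_zero)
open Literature.Analysis.ValidatedNumerics.NumericsMP

/-! ### (a) The supporting-line inequality -/

/-- **Supporting line:** for every `u` in the window, `C₁* ≤ Λ(u) + ustarD1·G(u)` — the Chernoff tangent plane at
slopes `σᵢ(u)` lies above the max-term entropy, in particular above its value `C₁*` at the critical abscissa. -/
theorem C₁starD1_le_tangent {u : ℝ} (hu : 47 / 2 < u) (hu' : u < 35) :
    C₁starD1 ≤ rateΛD1 u + ustarD1 * slopeGD1 u := by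
  have hA : Tendsto (fun n : ℕ => (constKD1 ustarD1 - penPD1 - 8) / (n : ℝ)) atTop (𝓝 0) :=
    tendsto_const_div_atTop_nhds_zero_nat _
  have hB : Tendsto (fun n : ℕ => Real.log (48 * n + 0) / (n : ℝ)) atTop (𝓝 0) :=
    tendsto_log_linear_div (by norm_num) le_rfl
  have hlo : Tendsto (fun n : ℕ => C₁starD1 + ((constKD1 ustarD1 - penPD1 - 8) / (n : ℝ) - 2 * (Real.log (48 * n + 0) / n)))
      atTop (𝓝 C₁starD1) := by
    simpa using tendsto_const_nhds.add (hA.sub (hB.const_mul 2))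
  have hhi : Tendsto (fun n : ℕ => (rateΛD1 u + ustarD1 * slopeGD1 u) + (|slopeGD1 u| + constKD1 u) / (n : ℝ)) atTop
      (𝓝 (rateΛD1 u + ustarD1 * slopeGD1 u)) := by
    simpa using tendsto_const_nhds.add (tendsto_const_div_atTop_nhds_zero_nat (|slopeGD1 u| + constKD1 u))
  refine le_of_tendsto_of_tendsto hlo hhi ?_
  filter_upwards [eventually_ge_atTop 1] with n hn
  have hnpos : (0:ℝ) < n := by exact_mod_cast hn
  have h1 := exp_le_termD1_kcrit hn
  have hk : 22 * n + 1 ≤ kcritD1 n := by have := (kcritD1_range hn).1; omega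
  have h2 := termD1_le_exp n (kcritD1 n) hk hu hu'
  have h12 := Real.exp_le_exp.mp (h1.trans h2)
  obtain ⟨hx0, hx1⟩ := kcritD1_real n
  have hkG : (kcritD1 n : ℝ) * slopeGD1 u ≤ ustarD1 * n * slopeGD1 u + |slopeGD1 u| := by
    have hd : |((kcritD1 n : ℝ) - ustarD1 * n)| ≤ 1 := by rw [abs_le]; constructor <;> linarith
    have h3 : |((kcritD1 n : ℝ) - ustarD1 * n) * slopeGD1 u| ≤ |slopeGD1 u| := by
      rw [abs_mul]; exact mul_le_of_le_one_left (abs_nonneg _) hd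
    have h4 := (abs_le.mp h3).2
    linarith
  rw [add_zero]
  have e1 : C₁starD1 + ((constKD1 ustarD1 - penPD1 - 8) / (n : ℝ) - 2 * (Real.log (48 * n) / n)) =
      (n * C₁starD1 + constKD1 ustarD1 - penPD1 - 2 * Real.log (48 * n) - 8) / n := by
    field_simp; ring
  have e2 : rateΛD1 u + ustarD1 * slopeGD1 u + (|slopeGD1 u| + constKD1 u) / (n : ℝ) =
      (n * rateΛD1 u + ustarD1 * n * slopeGD1 u + |slopeGD1 u| + constKD1 u) / n := by
    field_simp; ring
  rw [e1, e2]
  exact div_le_div_of_nonneg_right (by linarith) hnpos.le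

/-! ### (b) `slopeGD1` is antitone on the window; one-sided location of `ustarD1` -/

/-- All six logarithmic terms of `slopeGD1` are antitone on `(47/2, 35)`, hence so is `slopeGD1`. -/
theorem slopeGD1_antitone {s t : ℝ} (hs : 47 / 2 < s) (hst : s ≤ t) (ht : t < 35) : slopeGD1 t ≤ slopeGD1 s := by
  obtain ⟨⟨a0, b0⟩, ⟨a1, b1⟩, ⟨a2, b2⟩, ⟨a3, b3⟩⟩ := slopes_mem hs (lt_of_le_of_lt hst ht)
  obtain ⟨⟨c0, d0⟩, ⟨c1, d1⟩, ⟨c2, d2⟩, ⟨c3, d3⟩⟩ := slopes_mem (lt_of_lt_of_le hs hst) ht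
  have hs22 : (0:ℝ) < 2 * s - 22 := by linarith
  have hs9 : (0:ℝ) < s - 9 := by linarith
  have m0 : σ₀ t ≤ σ₀ s := by
    unfold σ₀; exact div_le_div_of_nonneg_left (by norm_num) hs22 (by linarith)
  have m1 : σ₁ t ≤ σ₁ s := by
    unfold σ₁; exact div_le_div_of_nonneg_left (by norm_num) hs9 (by linarith)
  have m2 : σ₂ s ≤ σ₂ t := by unfold σ₂; linarith
  have m3 : σ₃ s ≤ σ₃ t := by unfold σ₃; linarith
  have T1 : Real.log (1 - σ₀ s) ≤ Real.log (1 - σ₀ t) := Real.log_le_log (by linarith) (by linarith)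
  have T2 : Real.log (1 - σ₁ s) ≤ Real.log (1 - σ₁ t) := Real.log_le_log (by linarith) (by linarith)
  have T3 : Real.log (σ₂ s) ≤ Real.log (σ₂ t) := Real.log_le_log a2 m2
  have T4 : Real.log (1 - σ₂ t) ≤ Real.log (1 - σ₂ s) := Real.log_le_log (by linarith) (by linarith)
  have T5 : Real.log (σ₃ s) ≤ Real.log (σ₃ t) := Real.log_le_log a3 m3
  have T6 : Real.log (1 - σ₃ t) ≤ Real.log (1 - σ₃ s) := Real.log_le_log (by linarith) (by linarith)
  unfold slopeGD1
  linarith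

/-- If `slopeGD1 u₁ < 0` at some window point `u₁`, then `ustarD1 ≤ u₁`. -/
theorem ustarD1_le_of_neg {u₁ : ℝ} (h1 : 47 / 2 < u₁) (hneg : slopeGD1 u₁ < 0) : ustarD1 ≤ u₁ := by
  by_contra h
  have h' : u₁ < ustarD1 := lt_of_not_ge h
  have hanti := slopeGD1_antitone h1 h'.le ustarD1_bounds.2
  rw [ustarD1_spec.2] at hanti
  linarith

/-! ### (c) Kernel interval enclosures of signed sums of logarithms of rationals -/

/-- Enclosure of `log (p/q)` (`p, q` positive naturals) by the tree's interval logarithm. -/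
def logFrac (p q : ℕ) : Option MI :=
  if q = 0 then none else MI.logPos sc KL (MI.ofFrac sc (p : ℤ) q)

/-- Soundness of `logFrac`. -/
theorem mem_logFrac {p q : ℕ} {L : MI} (h : logFrac p q = some L) :
    MI.mem sc (Real.log ((p : ℝ) / (q : ℝ))) L := by
  unfold logFrac at h
  split_ifs at h with hq
  have hq' : 0 < q := Nat.pos_of_ne_zero hq
  have hx : MI.mem sc (((p : ℤ) : ℝ) / (q : ℝ)) (MI.ofFrac sc (p : ℤ) q) := MI.mem_ofFrac sc (p : ℤ) hq'
  push_cast at hx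
  exact (MI.mem_logPos sc_pos h hx).2

/-- Signed sum `Σ c·log(p/q)` of a list of triples `(c, p, q)`, enclosed. -/
def sumLogs : List (ℤ × ℕ × ℕ) → Option MI
  | [] => some ⟨0, 0⟩
  | (c, p, q) :: l =>
    match logFrac p q, sumLogs l with
    | some L, some T => some (T.add (L.mulInt c))
    | _, _ => none

/-- The real signed sum `Σ c·log(p/q)` of a list of triples `(c, p, q)`. -/
def realSumLogs : List (ℤ × ℕ × ℕ) → ℝ
  | [] => 0
  | (c, p, q) :: l => realSumLogs l + Real.log ((p : ℝ) / (q : ℝ)) * c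

/-- Soundness of `sumLogs`. -/
theorem mem_sumLogs : ∀ (l : List (ℤ × ℕ × ℕ)) {T : MI}, sumLogs l = some T → MI.mem sc (realSumLogs l) T
  | [], T, h => by
    simp only [sumLogs, Option.some.injEq] at h
    subst h
    exact mem_zero
  | (c, p, q) :: l, T, h => by
    simp only [sumLogs] at h
    split at h
    · rename_i L T' hL hT'
      simp only [Option.some.injEq] at h
      subst h
      exact MI.mem_add (mem_sumLogs l hT') (MI.mem_mulInt (mem_logFrac hL) c)
    · simp at h

/-- The eight terms of `rateΛD1 (32229/1000)`: slopes `σ₀ = 12500/21229`, `σ₁ = 7000/23229`, `σ₂ = 13229/16000`,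
`σ₃ = 10229/16000` and their complements. -/
def lamList0 : List (ℤ × ℕ × ℕ) :=
  [(-25, 12500, 21229), (47, 8729, 21229), (-7, 7000, 23229), (16, 16229, 23229),
   (19, 13229, 16000), (-35, 2771, 16000), (22, 10229, 16000), (-38, 5771, 16000)]

/-- The six terms of `slopeGD1 (32229/1000)`. -/
def gList0 : List (ℤ × ℕ × ℕ) :=
  [(-2, 8729, 21229), (-1, 16229, 23229), (-1, 13229, 16000), (1, 2771, 16000), (-1, 10229, 16000),
   (1, 5771, 16000)]

/-- The six terms of `slopeGD1 (3223/100)`: slopes `σ₀ = 1250/2123`, `σ₁ = 700/2323`, `σ₂ = 1323/1600`,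
`σ₃ = 1023/1600` and their complements. -/
def gList1 : List (ℤ × ℕ × ℕ) :=
  [(-2, 873, 2123), (-1, 1623, 2323), (-1, 1323, 1600), (1, 277, 1600), (-1, 1023, 1600), (1, 577, 1600)]

/-- `rateΛD1 (32229/1000)` is the signed sum over `lamList0`. -/
theorem rateΛD1_u0 : rateΛD1 (32229 / 1000) = realSumLogs lamList0 := by
  simp only [realSumLogs, lamList0]
  unfold rateΛD1 σ₀ σ₁ σ₂ σ₃
  push_cast
  norm_num
  ring

/-- `slopeGD1 (32229/1000)` is the signed sum over `gList0`. -/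
theorem slopeGD1_u0 : slopeGD1 (32229 / 1000) = realSumLogs gList0 := by
  simp only [realSumLogs, gList0]
  unfold slopeGD1 σ₀ σ₁ σ₂ σ₃
  push_cast
  norm_num
  ring

/-- `slopeGD1 (3223/100)` is the signed sum over `gList1`. -/
theorem slopeGD1_u1 : slopeGD1 (3223 / 100) = realSumLogs gList1 := by
  simp only [realSumLogs, gList1]
  unfold slopeGD1 σ₀ σ₁ σ₂ σ₃
  push_cast
  norm_num
  ring

/-- The kernel test: `G(u₀) ≥ 0`, `G(u₁) < 0`, `10⁴·(Λ(u₀) + u₁·G(u₀)) ≤ 608079` (scaled by `sc`). -/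
def encCheckD1 : Bool :=
  match sumLogs lamList0, sumLogs gList0, sumLogs gList1 with
  | some L, some G0, some G1 =>
    decide (0 ≤ G0.lo) && (decide (G1.hi < 0) && decide (10000 * L.hi + 322300 * G0.hi ≤ 608079 * (sc : ℤ)))
  | _, _, _ => false

/-- The kernel test passes. -/
theorem encCheckD1_eq : encCheckD1 = true := by
  decide +kernel

/-- Soundness of the kernel test. -/
theorem encCheckD1_sound (h : encCheckD1 = true) :
    0 ≤ slopeGD1 (32229 / 1000) ∧ slopeGD1 (3223 / 100) < 0 ∧
      rateΛD1 (32229 / 1000) + 3223 / 100 * slopeGD1 (32229 / 1000) ≤ 60.8079 := by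
  unfold encCheckD1 at h
  split at h
  · rename_i L G0 G1 hL hG0 hG1
    simp only [Bool.and_eq_true, decide_eq_true_eq] at h
    obtain ⟨i1, i2, i3⟩ := h
    have hS : (0 : ℝ) < sc := by exact_mod_cast sc_pos
    have mL := mem_sumLogs lamList0 hL
    have mG0 := mem_sumLogs gList0 hG0
    have mG1 := mem_sumLogs gList1 hG1
    rw [← rateΛD1_u0] at mL
    rw [← slopeGD1_u0] at mG0
    rw [← slopeGD1_u1] at mG1
    unfold MI.mem at mL mG0 mG1
    have c1 : (0 : ℝ) ≤ G0.lo := by exact_mod_cast i1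
    have c2 : (G1.hi : ℝ) < 0 := by exact_mod_cast i2
    have c3 : (10000 : ℝ) * L.hi + 322300 * G0.hi ≤ 608079 * (sc : ℝ) := by exact_mod_cast i3
    refine ⟨?_, ?_, ?_⟩
    · have key : 0 ≤ slopeGD1 (32229 / 1000) * sc := by linarith [mG0.1]
      nlinarith
    · have key : slopeGD1 (3223 / 100) * sc < 0 := by linarith [mG1.2]
      nlinarith
    · have key : (rateΛD1 (32229 / 1000) + 3223 / 100 * slopeGD1 (32229 / 1000)) * sc ≤ (60.8079 : ℝ) * sc := by
        nlinarith [mL.2, mG0.2]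
      exact le_of_mul_le_mul_right key hS
  · simp at h

/-! ### (d) The enclosure -/

/-- **`C₁* ≤ 60.8079`** (design `60.80787975`): supporting line at `u₀ = 32229/1000` with `G(u₀) ≥ 0` and
`u* ≤ u₁ = 3223/100`. -/
theorem C₁starD1_le : C₁starD1 ≤ 60.8079 := by
  obtain ⟨hG0, hG1, hB⟩ := encCheckD1_sound encCheckD1_eq
  have hu1 : ustarD1 ≤ 3223 / 100 := ustarD1_le_of_neg (by norm_num) hG1
  have hT := C₁starD1_le_tangent (u := 32229 / 1000) (by norm_num) (by norm_num)
  have hmono : ustarD1 * slopeGD1 (32229 / 1000) ≤ 3223 / 100 * slopeGD1 (32229 / 1000) :=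
    mul_le_mul_of_nonneg_right hu1 hG0
  linarith

/-- `C₁* ≤ 60.808` — the form used by the D1 note (`CoeffRateD1 60.808`). -/
theorem C₁starD1_le' : C₁starD1 ≤ 60.808 := C₁starD1_le.trans (by norm_num)

end Summit.KontsevichZagierPeriods.Zeta5Search.TwoTaleD1Growth

end
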